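import Summits.NavierStokesRegularity.FluidComputer.GateBudgetRearm
import Summits.NavierStokesRegularity.FluidComputer.GateBudgetSpentTooth
import HarnessLib

/-!
# What no tuning can beat, part 37: THE LATTICE DUD RE-FIRES — its clock crosses zero within
# `1.44` of the dousing time and its trigger is back at `K` times the entry level `1.43` later

Cell `pub-fluidc`, blueprint seat bp1 (gen 32, third item, with part 36); same namespace and
conventions as parts 1–36 (`GateBudget*.lean`); imports part 36 (`GateBudgetRearm`: the clock
re-arms, the trigger relights — general laws) and part 35 (`GateBudgetSpentTooth`:
`spent_exp_le`, and through part 32 the member's state at its dousing time `T`). Headline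
amplifier `M = K¹⁰`, `K ≥ 16`, `ε² ≤ 1/(6K²⁰)`, window `200ε/K²⁰ ≤ ρ² ≤ 2ε/K¹⁰`, LATTICE
condition `ε = k·K¹⁰ρ²` (`w = k ∈ ℕ`: a dud, parts 28/33). Modes `0 = a`, `1 = b` clock,
`2 = c` trigger, `3 = d`, `4 = ã` of `rotorCircuit K K¹⁰ ε ρ` from (5.6). HONEST FRAMING
(verbatim): low prior, high value-of-information experiment on Tao's machine paradigm; NOT a
claim that NS blows up. Nothing is proved about the Navier–Stokes equations.

WHAT (SPEC-INPUT-bp1 §AJ item (19), the numbers; `q = K⁻¹⁰`, `p = K⁻⁹`, `θ = 2755239/4·10⁸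
= 1 - (19931/20000)²`). §107 window facts and numerics; the clock is a priori small (`b² ≤ q`
on `[0, 5]`, part 1's `abs_b_le`). §108 PHASE 1 `knob_dud_rearm_clock`: from a doused state
(`b(T) ≤ -0.69ε`, `c(T) ≤ λ₀ρ²`, `|a(T)| ≥ 19931/20000`, `T ≤ 1.4144`) part 36's
`dud_clock_rearms` with `H = 1.44`, `β = (ε + σ)T`, budget `1.4144(1 + q) < 1.44(0.993 + q)`;
PHASE 2 `knob_dud_relight`: from `b(S) = 0`, `c(S) ≤ 2ρ²/K¹⁰`, `d² + ã² ≤ θ + 2q` part 36's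
`dud_refires` with `γ = ρ²/K⁹`, `Δ = 1.43`, `δ = 10⁻²`, loop gain `e^{(0.993·1.0224 - 1)K¹⁰}
≥ 0.0152K¹⁰ > 100K⁹/0.993`. §109 `knob_dud_refires`: every lattice member has `T` (dousing,
part 32: `√(2 - 24 log K/K¹⁰) ≤ T ≤ √(2 + 2/K¹⁰) + 242/K⁹`, `b(T) ≤ -0.69ε`),
`t_z ∈ [T + 0.69, T + 1.44)` (ZERO OF THE CLOCK; on `[T, t_z]`: `b ≤ 0`, `c ≤ 2ρ²/K¹⁰`,
`b(t) ≥ b(T) + 0.993ε(t - T)`, `a² ≥ 0.993`) and `r₁ ∈ (t_z, t_z + 1.43)` (RE-FIRE: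
`c(r₁) = ρ²/K⁹`, `K` times the entry level `ρ²/K¹⁰` of the first pulse; on `[t_z, r₁]`:
`c ≤ ρ²/K⁹`, `b(t) ≥ 0.993ε(t - t_z)`, `a² ≥ 0.993`). READING: after the window nothing
fires again for `1.38` (part 33) and a fired tooth is spent for `100` (part 35); a lattice dud
is the opposite — carrier full, clock re-armed through zero by `T + 1.44`, trigger relit
before `t_z + 1.43`: THE SECOND PULSE OF A DUD BEGINS IN `(√2 + 1.38, √2 + 2.87)` up to
`O(K⁻⁹)`; Tao's `3√2 ≈ √2 + 2.83` sits inside.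

HONEST LIMITS. (i) The slack is the clock at dousing: only `-1.4145ε ≤ b(T) ≤ -0.69ε` is typed
(true value `≈ -√2ε`), whence `t_z - T ∈ [0.69, 1.44)` instead of `≈ √2(1 ± 0.004)`; pinning
`b(T)` (via `b(s₀) ≥ ε(s₀ - o(1))` and the `(b, c)`-energy across the pulse) is the
successor's item and would give `3√2 ± 1%` on both sides. (ii) `r₁ - t_z` is bounded above
only. (iii) The re-fire is the START of the second pulse (`c = ρ²/K⁹`, clock positive and
rising, carrier full); its transfer (`d`, `ã`) is not followed. (iv) Lattice duds at
`M = K¹⁰`, `K ≥ 16`, window members only. (v) Nothing about Navier–Stokes.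
[cite: Tao2016AveragedNS, §5.5 Theorem 5.3, (5.5), (5.6), (b-eq), (c-eq), (energy-con)]
-/

noncomputable section

namespace Summit.NavierStokesRegularity.FluidComputer.GateBudget

open Real Set Filter Topology
open Literature.Analysis.FluidPDE.Tao2016AveragedNS

/-! ## §107 The numbers of the lattice dud at `M = K¹⁰` -/

/-- THE WINDOW FACTS at `M = K¹⁰` (`K ≥ 16`, `ε² ≤ 1/(6K²⁰)`, `K¹⁰ρ² ≤ 2ε`; `q = K⁻¹⁰`,
`p = K⁻⁹`, `e = e^{-K¹⁰}`, `θ = 2755239/4·10⁸`): `q ≤ 2⁻⁴⁰`, `q², q³ ≤ 2⁻⁴⁰q`, `e ≤ 2q²`,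
`eq ≤ 2q³`, `ρ² ≤ 2εq ≤ ε ≤ 1`, `16ε²q⁴ ≤ q`, `ρ²e ≤ εq`, `ε² ≤ q²/6`, `p ≤ 2⁻³⁶`, the rate
`0.993 + 6q + 3p ≤ 1 - θ`, the re-fire budget `p < 0.993·10⁻²·0.0152K¹⁰`.
[cite: Tao2016AveragedNS, §5.5 (5.5)] -/
theorem refire_window_facts {K ε ρ : ℝ} (hK : 16 ≤ K) (hε : 0 < ε)
    (hεK : ε ^ 2 ≤ 1 / (6 * K ^ 20)) (hhi : K ^ 10 * ρ ^ 2 ≤ 2 * ε) :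
    1 / K ^ 10 ≤ (1 : ℝ) / 1099511627776 ∧ (1 / K ^ 10) ^ 2 ≤ (1 / K ^ 10) / 1099511627776 ∧
      (1 / K ^ 10) ^ 3 ≤ (1 / K ^ 10) / 1099511627776 ∧ exp (-K ^ 10) ≤ 2 * (1 / K ^ 10) ^ 2 ∧
      exp (-K ^ 10) * (1 / K ^ 10) ≤ 2 * (1 / K ^ 10) ^ 3 ∧ ρ ^ 2 ≤ 2 * ε * (1 / K ^ 10) ∧
      ρ ^ 2 ≤ ε ∧ ε ≤ 1 ∧ ρ ^ 2 ≤ 1 ∧ 16 * ε ^ 2 * (1 / K ^ 10) ^ 4 ≤ 1 / K ^ 10 ∧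
      ρ ^ 2 * exp (-K ^ 10) ≤ ε * (1 / K ^ 10) ∧ ε ^ 2 ≤ (1 / K ^ 10) ^ 2 / 6 ∧
      1 / K ^ 9 ≤ (1 : ℝ) / 68719476736 ∧
      (993 : ℝ) / 1000 + 6 * (1 / K ^ 10) + 3 * (1 / K ^ 9) ≤ 1 - 2755239 / 400000000 ∧
      1 / K ^ 9 < (993 : ℝ) / 1000 * (1 / 100) * (152 / 10000 * K ^ 10) := by
  have hK0 : 0 < K := by linarith
  have hK10 : 0 < K ^ 10 := by positivity
  have h9 : (68719476736 : ℝ) ≤ K ^ 9 := by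
    have := headline_pow_floor hK 9; norm_num at this; exact this
  have h10 : (1099511627776 : ℝ) ≤ K ^ 10 := by
    have := headline_pow_floor hK 10; norm_num at this; exact this
  have hp1 : 1 / K ^ 9 ≤ (1 : ℝ) / 68719476736 := one_div_le_one_div_of_le (by norm_num) h9
  have he := spent_exp_le hK
  rw [show (2 : ℝ) / K ^ 20 = 2 * (1 / K ^ 10) ^ 2 by field_simp] at he
  rw [show 1 / (6 * K ^ 20) = (1 / K ^ 10) ^ 2 / 6 by field_simp] at hεK
  set q : ℝ := 1 / K ^ 10 with hq
  have hq0 : 0 < q := by positivity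
  have hqK : q * K ^ 10 = 1 := by rw [hq]; field_simp
  have hq1 : q ≤ 1 / 1099511627776 := one_div_le_one_div_of_le (by norm_num) h10
  have hq2 : q ^ 2 ≤ q / 1099511627776 := by nlinarith only [hq1, hq0]
  have hq3 : q ^ 3 ≤ q / 1099511627776 := by nlinarith only [hq2, hq1, hq0]
  have he0 := (exp_pos (-K ^ 10)).le
  have hρq : ρ ^ 2 ≤ 2 * ε * q :=
    calc ρ ^ 2 = K ^ 10 * ρ ^ 2 * q := by
          rw [mul_comm (K ^ 10), mul_assoc, mul_comm (K ^ 10), hqK, mul_one]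
      _ ≤ 2 * ε * q := mul_le_mul_of_nonneg_right hhi hq0.le
  have hε1 : ε ≤ 1 := by nlinarith only [hεK, hq1, hq0, hε]
  have hρε : ρ ^ 2 ≤ ε := by nlinarith only [hρq, hq1, hε]
  have heq : exp (-K ^ 10) ≤ q := by nlinarith only [he, hq1, hq0]
  refine ⟨hq1, hq2, hq3, he, by nlinarith only [he, hq0], hρq, hρε, hε1, hρε.trans hε1, ?_, ?_,
    hεK, hp1, by linarith only [hq1, hp1], lt_of_le_of_lt hp1 (by linarith only [h10])⟩
  · have h1 : q ^ 4 ≤ 1 := pow_le_one₀ hq0.le (by linarith only [hq1])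
    have h2 : ε ^ 2 * q ^ 4 ≤ ε ^ 2 := mul_le_of_le_one_right (sq_nonneg ε) h1
    linarith only [h2, hεK, hq2, hq0]
  · calc ρ ^ 2 * exp (-K ^ 10) ≤ ε * exp (-K ^ 10) := mul_le_mul_of_nonneg_right hρε he0
      _ ≤ ε * q := mul_le_mul_of_nonneg_left heq hε.le

variable {K ε ρ : ℝ} {X : ℝ → Fin 5 → ℝ} {C : ℝ → ℝ}

/-- THE CLOCK IS A PRIORI SMALL: `b(t)² ≤ K⁻¹⁰` for `0 ≤ t ≤ 5` (`|b(t)| ≤ (ε + σ)t ≤ 10ε`,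
part 1's `abs_b_le`, and `100ε² ≤ 17K⁻²⁰`). [cite: Tao2016AveragedNS, §5.5 (b-eq), (c-eq)] -/
theorem refire_clock_small
    (hX : ∀ t, HasDerivAt X (RotorKnob.rotorCircuit K (K ^ 10) ε ρ (X t)) t)
    (h0 : X 0 = delayInit) (hK : 16 ≤ K) (hε : 0 < ε) (hεK : ε ^ 2 ≤ 1 / (6 * K ^ 20))
    (hρ : 0 < ρ) (hhi : K ^ 10 * ρ ^ 2 ≤ 2 * ε) {r : ℝ} (hr : 0 ≤ r) (hr5 : r ≤ 5) :
    X r 1 ^ 2 ≤ 1 / K ^ 10 := by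
  have hK0 : 0 < K := by linarith
  obtain ⟨hq1, hq2, -, -, -, -, -, -, -, -, hσq, hε2, -⟩ := refire_window_facts hK hε hεK hhi
  have hq0 : 0 < 1 / K ^ 10 := by positivity
  have hXf := hX
  rw [RotorKnob.rotorCircuit_eq_fiveGate] at hXf
  have hb := abs_b_le hXf h0 hε.le (by positivity) hr
  have h1 : (ε + ρ ^ 2 * exp (-K ^ 10)) * r ≤ 10 * ε := by
    have h2 : ρ ^ 2 * exp (-K ^ 10) ≤ ε := hσq.trans (by nlinarith only [hq1, hε])
    nlinarith only [h2, hr, hr5, hε, (exp_pos (-K ^ 10)).le, sq_nonneg ρ]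
  have h3 : X r 1 ^ 2 ≤ (10 * ε) ^ 2 := by
    rw [← sq_abs]; exact pow_le_pow_left₀ (abs_nonneg _) (hb.trans h1) 2
  linarith only [h3, hε2, hq2, hq0]

/-! ## §108 Phase 1: the clock re-arms; phase 2: the trigger relights -/

/-- **PHASE 1 — THE CLOCK RE-ARMS** (`M = K¹⁰`, `K ≥ 16`, window member): from a doused state
at `T ≤ 1.4144` (`b(T) ≤ -0.69ε`, `c(T) ≤ λ₀ρ²`, `|a(T)| ≥ 19931/20000`) the clock crosses
zero at `t_z ∈ [T + 0.69, T + 1.44)`, and on `[T, t_z]`: `b ≤ 0`, `c ≤ 2ρ²/K¹⁰`,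
`b(t) ≥ b(T) + 0.993ε(t - T)`, `a² ≥ 0.993`, `d² + ã² ≤ θ + 2/K¹⁰` (part 36's
`dud_clock_rearms`, `H = 1.44`). [cite: Tao2016AveragedNS, §5.5 Theorem 5.3, (b-eq), (c-eq)] -/
theorem knob_dud_rearm_clock
    (hX : ∀ t, HasDerivAt X (RotorKnob.rotorCircuit K (K ^ 10) ε ρ (X t)) t)
    (h0 : X 0 = delayInit) (hK : 16 ≤ K) (hε : 0 < ε) (hεK : ε ^ 2 ≤ 1 / (6 * K ^ 20))
    (hρ : 0 < ρ) (hhi : K ^ 10 * ρ ^ 2 ≤ 2 * ε) {T : ℝ} (hT : 0 ≤ T) (hT14 : T ≤ 14144 / 10000)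
    (hbT : X T 1 ≤ -(69 / 100 * ε))
    (hcT : X T 2 ≤ (1 / K ^ 10 + 4 * exp (-K ^ 10) / K ^ 10) * ρ ^ 2)
    (hpin : 19931 / 20000 ≤ |X T 0|) :
    ∃ tz, T + 69 / 100 ≤ tz ∧ tz < T + 36 / 25 ∧ X tz 1 = 0 ∧ ∀ r ∈ Icc T tz,
      X r 1 ≤ 0 ∧ X r 2 ≤ 2 * ρ ^ 2 / K ^ 10 ∧ X T 1 + 993 / 1000 * ε * (r - T) ≤ X r 1 ∧
      993 / 1000 ≤ X r 0 ^ 2 ∧ X r 3 ^ 2 + X r 4 ^ 2 ≤ 2755239 / 400000000 + 2 / K ^ 10 := by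
  have hK0 : 0 < K := by linarith
  have hK10 : 0 < K ^ 10 := by positivity
  obtain ⟨-, hq2, hq3, he2, heq, hρq, -, -, hρ1, h16, hσq, -, -, hn2, -⟩ :=
    refire_window_facts hK hε hεK hhi
  rw [show (1 / K ^ 10 + 4 * exp (-K ^ 10) / K ^ 10) * ρ ^ 2
    = (1 + 4 * exp (-K ^ 10)) * (1 / K ^ 10) * ρ ^ 2 by ring] at hcT
  rw [show (2 : ℝ) / K ^ 10 = 2 * (1 / K ^ 10) by ring,
    show 2 * ρ ^ 2 / K ^ 10 = 2 * (1 / K ^ 10) * ρ ^ 2 by ring]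
  have hp0 : (0 : ℝ) ≤ 1 / K ^ 9 := by positivity
  set q : ℝ := 1 / K ^ 10 with hq
  have hq0 : 0 < q := by positivity
  have he0 : 0 ≤ exp (-K ^ 10) := (exp_pos _).le
  have hXf := hX
  rw [RotorKnob.rotorCircuit_eq_fiveGate] at hXf
  have hσ0 : 0 ≤ ρ ^ 2 * exp (-K ^ 10) := by positivity
  have hμ0 : 0 ≤ ε⁻¹ * K ^ 10 := by positivity
  -- the output pair at `T`: `d² + ã² ≤ θ` (the pin and the energy identity)
  have hθ : X T 3 ^ 2 + X T 4 ^ 2 ≤ 2755239 / 400000000 := by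
    have h := pow_le_pow_left₀ (by norm_num) hpin 2
    rw [sq_abs] at h
    nlinarith only [h, RotorKnob.traj_sum_sq_eq_one hX h0 T, sq_nonneg (X T 1), sq_nonneg (X T 2)]
  have hβ : -((ε + ρ ^ 2 * exp (-K ^ 10)) * T) ≤ X T 1 :=
    (abs_le.1 (abs_b_le hXf h0 hε.le hσ0 hT)).1
  have hν : ∀ r ∈ Icc T (T + 36 / 25), X r 1 ^ 2 ≤ q := fun r hr =>
    refire_clock_small hX h0 hK hε hεK hρ hhi (hT.trans hr.1) (by linarith only [hr.2, hT14])
  -- the level `λ₁ = (1 + 4e)q + 1.44e ≤ 2q` and the dose `1.44λ₀ + 1.44²e/2 ≤ 2q`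
  have hl1 : (1 + 4 * exp (-K ^ 10)) * q + exp (-K ^ 10) * (36 / 25) ≤ 2 * q := by
    linarith only [heq, he2, hq2, hq3, hq0]
  have hdose : (1 + 4 * exp (-K ^ 10)) * q * (36 / 25) + exp (-K ^ 10) * (36 / 25) ^ 2 / 2
      ≤ 2 * q := by
    linarith only [heq, he2, hq2, hq3, hq0]
  have hcσ : (1 + 4 * exp (-K ^ 10)) * q * ρ ^ 2 + ρ ^ 2 * exp (-K ^ 10) * (36 / 25)
      = ((1 + 4 * exp (-K ^ 10)) * q + exp (-K ^ 10) * (36 / 25)) * ρ ^ 2 := by ring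
  have hc1 : (((1 + 4 * exp (-K ^ 10)) * q + exp (-K ^ 10) * (36 / 25)) * ρ ^ 2) ^ 2
      ≤ 16 * ε ^ 2 * q ^ 4 := by
    have h1 : ((1 + 4 * exp (-K ^ 10)) * q + exp (-K ^ 10) * (36 / 25)) * ρ ^ 2
        ≤ 4 * ε * q ^ 2 :=
      calc _ ≤ 2 * q * (2 * ε * q) := mul_le_mul hl1 hρq (sq_nonneg ρ) (by positivity)
        _ = 4 * ε * q ^ 2 := by ring
    calc _ ≤ (4 * ε * q ^ 2) ^ 2 := pow_le_pow_left₀ (by positivity) h1 2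
      _ = 16 * ε ^ 2 * q ^ 4 := by ring
  have hRd : (ρ ^ 2)⁻¹ * ((1 + 4 * exp (-K ^ 10)) * q * ρ ^ 2 * (36 / 25)
      + ρ ^ 2 * exp (-K ^ 10) * (36 / 25) ^ 2 / 2)
      = (1 + 4 * exp (-K ^ 10)) * q * (36 / 25) + exp (-K ^ 10) * (36 / 25) ^ 2 / 2 := by
    field_simp
  -- the rate `κ₁ ≥ 0.993ε + εq`
  have hκ : 993 / 1000 * ε + ε * q
      ≤ ε * (1 - q - (((1 + 4 * exp (-K ^ 10)) * q + exp (-K ^ 10) * (36 / 25)) * ρ ^ 2) ^ 2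
          - 2755239 / 400000000
          - ((1 + 4 * exp (-K ^ 10)) * q * (36 / 25) + exp (-K ^ 10) * (36 / 25) ^ 2 / 2))
        - ε⁻¹ * K ^ 10
          * (((1 + 4 * exp (-K ^ 10)) * q + exp (-K ^ 10) * (36 / 25)) * ρ ^ 2) ^ 2 := by
    have hS1 := (mul_le_mul_of_nonneg_left hc1 hε.le).trans (mul_le_mul_of_nonneg_left h16 hε.le)
    have hS3 : ε⁻¹ * K ^ 10
        * (((1 + 4 * exp (-K ^ 10)) * q + exp (-K ^ 10) * (36 / 25)) * ρ ^ 2) ^ 2 ≤ ε * q := by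
      have h1 := mul_le_mul_of_nonneg_left hc1 hμ0
      rw [show ε⁻¹ * K ^ 10 * (16 * ε ^ 2 * q ^ 4) = 16 * ε * q ^ 3 by rw [hq]; field_simp] at h1
      nlinarith only [h1, mul_le_mul_of_nonneg_left hq3 hε.le, mul_pos hε hq0]
    nlinarith only [hS1, mul_le_mul_of_nonneg_left hdose hε.le, hS3,
      mul_le_mul_of_nonneg_left hn2 hε.le, mul_nonneg hε.le hp0]
  -- part 36, with the budget `(ε + σ)T ≤ 1.4144(1 + q)ε < 1.44(0.993 + q)ε ≤ κ₁H`
  obtain ⟨tz, htzm, htzH, hbz, hP, hcz, hoz, hclz, hzlow⟩ :=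
    dud_clock_rearms hXf h0 hε.le hσ0 hμ0 (by positivity) hT (by linarith only [hbT, hε]) hβ hcT
      hθ hν (by norm_num) (by
        rw [hRd, hcσ]
        have hL : (ε + ρ ^ 2 * exp (-K ^ 10)) * T ≤ (ε + ε * q) * (14144 / 10000) :=
          mul_le_mul (by linarith only [hσq]) hT14 hT (by positivity)
        nlinarith only [hL, hκ, hε, mul_pos hε hq0])
  have hH : ∀ r ∈ Icc T tz, 0 ≤ r - T ∧ r - T ≤ 36 / 25 := fun r hr =>
    ⟨by linarith only [hr.1], by linarith only [hr.2, htzm.2]⟩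
  -- the trigger and the output pair on `[T, tz]`
  have hcz' : ∀ r ∈ Icc T tz, X r 2 ≤ 2 * q * ρ ^ 2 := fun r hr => by
    have h2 : ρ ^ 2 * exp (-K ^ 10) * (r - T) ≤ ρ ^ 2 * exp (-K ^ 10) * (36 / 25) :=
      mul_le_mul_of_nonneg_left (hH r hr).2 hσ0
    nlinarith only [hcz r hr, h2, mul_le_mul_of_nonneg_right hl1 (sq_nonneg ρ)]
  have hoz' : ∀ r ∈ Icc T tz, X r 3 ^ 2 + X r 4 ^ 2 ≤ 2755239 / 400000000 + 2 * q :=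
    fun r hr => by
    have h1 := hoz r hr
    rw [show (ρ ^ 2)⁻¹ * ((1 + 4 * exp (-K ^ 10)) * q * ρ ^ 2 * (r - T)
        + ρ ^ 2 * exp (-K ^ 10) * (r - T) ^ 2 / 2)
        = (1 + 4 * exp (-K ^ 10)) * q * (r - T) + exp (-K ^ 10) * (r - T) ^ 2 / 2 by
      field_simp] at h1
    have h3 : (1 + 4 * exp (-K ^ 10)) * q * (r - T) ≤ (1 + 4 * exp (-K ^ 10)) * q * (36 / 25) :=
      mul_le_mul_of_nonneg_left (hH r hr).2 (by positivity)
    have h5 := mul_le_mul_of_nonneg_left (pow_le_pow_left₀ (hH r hr).1 (hH r hr).2 2) he0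
    nlinarith only [h1, h3, h5, hdose]
  have htz69 : T + 69 / 100 ≤ tz := by
    have h1 : ε * (69 / 100) ≤ ε * (tz - T) := by nlinarith only [hzlow, hbT]
    linarith only [le_of_mul_le_mul_left h1 hε]
  refine ⟨tz, htz69, htzH, hbz, fun r hr => ⟨hP r hr, hcz' r hr, ?_, ?_, hoz' r hr⟩⟩
  · have h1 := hclz r hr
    rw [hRd, hcσ] at h1
    nlinarith only [h1, mul_le_mul_of_nonneg_right hκ (hH r hr).1,
      mul_nonneg (mul_nonneg hε.le hq0.le) (hH r hr).1]
  · have hb2 : X r 1 ^ 2 ≤ q := hν r ⟨hr.1, by linarith only [hr.2, htzH]⟩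
    have hc2 : X r 2 ^ 2 ≤ (2 * q * ρ ^ 2) ^ 2 :=
      pow_le_pow_left₀ (RotorKnob.c_nonneg hX h0 (hT.trans hr.1)) (hcz' r hr) 2
    have hρ4 : (ρ ^ 2) ^ 2 ≤ 1 := pow_le_one₀ (sq_nonneg ρ) hρ1
    have hc3 := mul_le_mul_of_nonneg_left hρ4 (by positivity : (0 : ℝ) ≤ 4 * q ^ 2)
    nlinarith only [RotorKnob.traj_sum_sq_eq_one hX h0 r, hb2, hc2, hc3, hoz' r hr, hn2, hq2,
      hq0, hp0]

/-- **PHASE 2 — THE TRIGGER RELIGHTS** (`M = K¹⁰`, `K ≥ 16`, window member): from `b(S) = 0`,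
`c(S) ≤ 2ρ²/K¹⁰`, `d(S)² + ã(S)² ≤ θ + 2/K¹⁰`, `S ≤ 7/2`, the trigger is back at `ρ²/K⁹` at
some `r₁ ∈ (S, S + 1.43)`, and on `[S, r₁]`: `c ≤ ρ²/K⁹`, `b(t) ≥ 0.993ε(t - S)`,
`a² ≥ 0.993` (part 36's `dud_refires`, `γ = ρ²/K⁹`, `Δ = 1.43`, `δ = 10⁻²`; loop gain
`e^{(0.993·1.0224 - 1)K¹⁰} ≥ 0.0152K¹⁰`). [cite: Tao2016AveragedNS, §5.5 Theorem 5.3, (c-eq)] -/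
theorem knob_dud_relight
    (hX : ∀ t, HasDerivAt X (RotorKnob.rotorCircuit K (K ^ 10) ε ρ (X t)) t)
    (h0 : X 0 = delayInit) (hK : 16 ≤ K) (hε : 0 < ε) (hεK : ε ^ 2 ≤ 1 / (6 * K ^ 20))
    (hρ : 0 < ρ) (hhi : K ^ 10 * ρ ^ 2 ≤ 2 * ε) {S : ℝ} (hS : 0 ≤ S) (hS7 : S ≤ 7 / 2)
    (hbS : X S 1 = 0) (hcS : X S 2 ≤ 2 * ρ ^ 2 / K ^ 10)
    (hoS : X S 3 ^ 2 + X S 4 ^ 2 ≤ 2755239 / 400000000 + 2 / K ^ 10) :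
    ∃ r₁, S < r₁ ∧ r₁ < S + 143 / 100 ∧ X r₁ 2 = ρ ^ 2 / K ^ 9 ∧ ∀ r ∈ Icc S r₁,
      X r 2 ≤ ρ ^ 2 / K ^ 9 ∧ 993 / 1000 * ε * (r - S) ≤ X r 1 ∧ 993 / 1000 ≤ X r 0 ^ 2 := by
  have hK0 : 0 < K := by linarith
  have hK9 : 0 < K ^ 9 := by positivity
  have hK10 : 0 < K ^ 10 := by positivity
  obtain ⟨-, -, -, -, -, hρq, -, -, hρ1, -, -, -, hp1, hn2, hn3⟩ :=
    refire_window_facts hK hε hεK hhi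
  rw [show (2 : ℝ) / K ^ 10 = 2 * (1 / K ^ 10) by ring] at hoS
  rw [show 2 * ρ ^ 2 / K ^ 10 = 2 * (1 / K ^ 10) * ρ ^ 2 by ring] at hcS
  rw [show ρ ^ 2 / K ^ 9 = 1 / K ^ 9 * ρ ^ 2 by ring]
  set q : ℝ := 1 / K ^ 10 with hq
  set p : ℝ := 1 / K ^ 9 with hp
  have hq0 : 0 < q := by positivity
  have hp0 : 0 < p := by positivity
  have hqp : 2 * q < p := by
    rw [hq, hp, show 2 * (1 / K ^ 10) = 2 / K ^ 10 by ring, div_lt_div_iff₀ hK10 hK9]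
    nlinarith only [hK, hK9, show K ^ 10 = K * K ^ 9 by ring]
  have hXf := hX
  rw [RotorKnob.rotorCircuit_eq_fiveGate] at hXf
  have hμ0 : 0 ≤ ε⁻¹ * K ^ 10 := by positivity
  have hρ2 : 0 < ρ ^ 2 := by positivity
  have hqρ : 2 * q * ρ ^ 2 < p * ρ ^ 2 := mul_lt_mul_of_pos_right hqp hρ2
  have hν : ∀ r ∈ Icc S (S + 143 / 100), X r 1 ^ 2 ≤ q := fun r hr =>
    refire_clock_small hX h0 hK hε hεK hρ hhi (hS.trans hr.1) (by linarith only [hr.2, hS7])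
  have hRγ : (ρ ^ 2)⁻¹ * (p * ρ ^ 2 * (143 / 100)) = 143 / 100 * p := by field_simp
  have hγ2 : (p * ρ ^ 2) ^ 2 ≤ p := by
    have hρ4 : (ρ ^ 2) ^ 2 ≤ 1 := pow_le_one₀ hρ2.le hρ1
    nlinarith only [mul_le_mul_of_nonneg_left hρ4 (sq_nonneg p), hp1, hp0]
  have hμγ : ε⁻¹ * K ^ 10 * (p * ρ ^ 2) ^ 2 ≤ ε * q := by
    have h2 := mul_le_mul_of_nonneg_left
      (mul_le_mul_of_nonneg_left hρq (by positivity : 0 ≤ p ^ 2 * ρ ^ 2)) hμ0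
    rw [show ε⁻¹ * K ^ 10 * (p ^ 2 * ρ ^ 2 * (2 * ε * q)) = 2 * p ^ 2 * ρ ^ 2 by
      rw [hq]; field_simp] at h2
    have h4 := mul_le_mul_of_nonneg_left hρq (by positivity : 0 ≤ 2 * p ^ 2)
    have h6 := mul_le_mul_of_nonneg_right (by nlinarith only [hp1, hp0] : p ^ 2 ≤ 1 / 4)
      (by positivity : 0 ≤ 4 * ε * q)
    nlinarith only [h2, h4, h6]
  set α := 1 - q - (p * ρ ^ 2) ^ 2 - (2755239 / 400000000 + 2 * q)
    - (ρ ^ 2)⁻¹ * (p * ρ ^ 2 * (143 / 100)) with hα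
  have hα1 : 993 / 1000 + q ≤ α := by
    rw [hα, hRγ]; linarith only [hn2, hγ2, hp0, hq0]
  have hα0 : 993 / 1000 ≤ α := by linarith only [hα1, hq0]
  set κ := ε * α - ε⁻¹ * K ^ 10 * (p * ρ ^ 2) ^ 2 with hκ
  have hκ1 : 993 / 1000 * ε ≤ κ := by
    rw [hκ]; nlinarith only [mul_le_mul_of_nonneg_left hα1 hε.le, hμγ]
  -- the loop gain `e^{-K¹⁰}·e^{κμ(Δ² - δ²)/2} ≥ 0.0152K¹⁰`
  have hE : 152 / 10000 * K ^ 10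
      ≤ exp (-K ^ 10) * exp (κ * (ε⁻¹ * K ^ 10) * ((143 / 100) ^ 2 - (1 / 100) ^ 2) / 2) := by
    have h2 := mul_le_mul_of_nonneg_right hκ1 hμ0
    rw [show 993 / 1000 * ε * (ε⁻¹ * K ^ 10) = 993 / 1000 * K ^ 10 by field_simp] at h2
    rw [← exp_add]
    nlinarith only [h2, hK10,
      add_one_le_exp (-K ^ 10 + κ * (ε⁻¹ * K ^ 10) * ((143 / 100) ^ 2 - (1 / 100) ^ 2) / 2)]
  -- the budget `γ = pρ² < 0.993·10⁻²·0.0152K¹⁰ρ² ≤ σαδ·e^{κμ(Δ² - δ²)/2}`, and part 36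
  have hbud : p * ρ ^ 2 < ρ ^ 2 * exp (-K ^ 10) * α * (1 / 100)
      * exp (κ * (ε⁻¹ * K ^ 10) * ((143 / 100) ^ 2 - (1 / 100) ^ 2) / 2) := by
    have h2 := mul_le_mul_of_nonneg_left (mul_le_mul hα0 hE (by positivity) (by linarith))
      (by positivity : (0 : ℝ) ≤ ρ ^ 2 * (1 / 100))
    calc p * ρ ^ 2 = ρ ^ 2 * p := mul_comm _ _
      _ < ρ ^ 2 * (993 / 1000 * (1 / 100) * (152 / 10000 * K ^ 10)) :=
          mul_lt_mul_of_pos_left hn3 hρ2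
      _ = ρ ^ 2 * (1 / 100) * (993 / 1000 * (152 / 10000 * K ^ 10)) := by ring
      _ ≤ ρ ^ 2 * (1 / 100) * (α * (exp (-K ^ 10)
          * exp (κ * (ε⁻¹ * K ^ 10) * ((143 / 100) ^ 2 - (1 / 100) ^ 2) / 2))) := h2
      _ = _ := by ring
  have hκ0 : 0 ≤ κ := by linarith only [hκ1, hε]
  obtain ⟨r₁, hr₁m, hr₁Δ, hcr₁, hQ, -, hcl, ha⟩ :=
    dud_refires (δ := 1 / 100) hXf h0 hε.le (by positivity) hμ0 (by positivity) hS hbS.ge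
      (hcS.trans hqρ.le) hoS hν (by norm_num) (by norm_num) hκ0 hbud
  have hS1 : S < r₁ := by
    rcases lt_or_eq_of_le hr₁m.1 with h | h
    · exact h
    · exfalso; rw [← h] at hcr₁; linarith only [hcr₁, hcS, hqρ]
  refine ⟨r₁, hS1, hr₁Δ, hcr₁, fun r hr => ⟨hQ r hr, ?_, hα0.trans (ha r hr)⟩⟩
  have h1 := hcl r hr
  rw [hbS, zero_add] at h1
  exact (mul_le_mul_of_nonneg_right hκ1 (by linarith only [hr.1])).trans h1

/-! ## §109 The lattice dud re-fires -/

/-- **THE LATTICE DUD RE-FIRES.** At `M = K¹⁰` (`K ≥ 16`, `0 < ε`, `ε² ≤ 1/(6K²⁰)`), along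
the exact trajectory of `rotorCircuit K K¹⁰ ε ρ` from (5.6), every LATTICE member of the
window (`200ε/K²⁰ ≤ ρ² ≤ 2ε/K¹⁰`, `ε = k·K¹⁰ρ²`) has times `T, t_z, r₁`: `√(2 - 24 log K/K¹⁰)
≤ T ≤ √(2 + 2/K¹⁰) + 242/K⁹`, `b(T) ≤ -0.69ε` (dousing, part 32); `T + 0.69 ≤ t_z < T + 1.44`,
`b(t_z) = 0`, on `[T, t_z]`: `b ≤ 0`, `c ≤ 2ρ²/K¹⁰`, `b(t) ≥ b(T) + 0.993ε(t - T)`,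
`a² ≥ 0.993` (THE CLOCK RE-ARMS); `t_z < r₁ < t_z + 1.43`, `c(r₁) = ρ²/K⁹`, on `[t_z, r₁]`:
`c ≤ ρ²/K⁹`, `b(t) ≥ 0.993ε(t - t_z)`, `a² ≥ 0.993` (THE TRIGGER RELIGHTS to `K` times its
first entry level). [cite: Tao2016AveragedNS, §5.5 Theorem 5.3, (5.6), (b-eq), (c-eq)] -/
theorem knob_dud_refires
    (hX : ∀ t, HasDerivAt X (RotorKnob.rotorCircuit K (K ^ 10) ε ρ (X t)) t)
    (h0 : X 0 = delayInit) (hC : ∀ t, HasDerivAt C (X t 2) t) (hK : 16 ≤ K) (hε : 0 < ε)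
    (hεK : ε ^ 2 ≤ 1 / (6 * K ^ 20)) (hρ : 0 < ρ) (hlo : 200 * ε / K ^ 20 ≤ ρ ^ 2)
    (hhi : K ^ 10 * ρ ^ 2 ≤ 2 * ε) (k : ℕ) (hk : ε = k * K ^ 10 * ρ ^ 2) :
    ∃ T tz r₁ : ℝ, √(2 - 24 * Real.log K / K ^ 10) ≤ T ∧ T ≤ √(2 + 2 / K ^ 10) + 242 / K ^ 9 ∧
      X T 1 ≤ -(69 / 100 * ε) ∧ T + 69 / 100 ≤ tz ∧ tz < T + 36 / 25 ∧ X tz 1 = 0 ∧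
      (∀ r ∈ Icc T tz, X r 1 ≤ 0 ∧ X r 2 ≤ 2 * ρ ^ 2 / K ^ 10 ∧
        X T 1 + 993 / 1000 * ε * (r - T) ≤ X r 1 ∧ 993 / 1000 ≤ X r 0 ^ 2) ∧
      tz < r₁ ∧ r₁ < tz + 143 / 100 ∧ X r₁ 2 = ρ ^ 2 / K ^ 9 ∧
      (∀ r ∈ Icc tz r₁, X r 2 ≤ ρ ^ 2 / K ^ 9 ∧ 993 / 1000 * ε * (r - tz) ≤ X r 1 ∧
        993 / 1000 ≤ X r 0 ^ 2) := by
  have hK0 : 0 < K := by linarith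
  obtain ⟨hq1, -, -, -, -, -, -, -, -, -, -, -, hp1, -⟩ := refire_window_facts hK hε hεK hhi
  -- part 32: the member's state at its dousing time `T`; on the lattice `|a(T)| ≥ 19931/20000`
  obtain ⟨s₀, T, hsq1, hsq2, hs1, -, hsT, hTs, -, hcT, -, -, -, haT, -, hb69⟩ :=
    knob_member_state_headline_clock hX h0 hC hK hε hεK hρ hlo hhi
  have hw : ε / (K ^ 10 * ρ ^ 2) = k := by
    rw [div_eq_iff (by positivity), hk]; ring
  have hsin : |sin (ε / (K ^ 10 * ρ ^ 2) * π)| = 0 := by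
    rw [hw, Real.sin_nat_mul_pi, abs_zero]
  have hcos : |cos (ε / (K ^ 10 * ρ ^ 2) * π)| = 1 := by
    rw [hw]; exact_mod_cast Real.abs_cos_int_mul_pi k
  rw [hsin, hcos] at haT
  have hs0 : 0 ≤ s₀ := by linarith only [hs1]
  have hT0 : 0 ≤ T := by linarith only [hs1, hsT]
  -- `s₀² ≤ 2 + 2q` gives `s₀ ≤ 1.4143`, so `T ≤ 1.4144`
  have hs14 : s₀ ≤ 14143 / 10000 := by
    have h2 : (2 : ℝ) / K ^ 10 ≤ 2 / 1099511627776 := by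
      rw [show (2 : ℝ) / K ^ 10 = 2 * (1 / K ^ 10) by ring]; linarith only [hq1]
    nlinarith only [hsq2, h2, hs0]
  have hT14 : T ≤ 14144 / 10000 := by
    rw [show (242 : ℝ) / K ^ 9 = 242 * (1 / K ^ 9) by ring] at hTs
    linarith only [hTs, hs14, hp1]
  -- phase 1 from `T`, phase 2 from `t_z ≤ 7/2`
  obtain ⟨tz, htz69, htzH, hbz, hP⟩ :=
    knob_dud_rearm_clock hX h0 hK hε hεK hρ hhi hT0 hT14 hb69 hcT (by linarith only [haT])
  obtain ⟨-, hcz, -, -, hoz⟩ := hP tz ⟨by linarith only [htz69], le_rfl⟩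
  obtain ⟨r₁, hS1, hr₁Δ, hcr₁, hQ⟩ := knob_dud_relight hX h0 hK hε hεK hρ hhi
    (by linarith only [hT0, htz69]) (by linarith only [htzH, hT14]) hbz hcz hoz
  exact ⟨T, tz, r₁, ((Real.sqrt_le_left hs0).2 hsq1).trans hsT.le,
    by linarith only [Real.le_sqrt_of_sq_le hsq2, hTs], hb69, htz69, htzH, hbz,
    fun r hr => ⟨(hP r hr).1, (hP r hr).2.1, (hP r hr).2.2.1, (hP r hr).2.2.2.1⟩,
    hS1, hr₁Δ, hcr₁, hQ⟩

end Summit.NavierStokesRegularity.FluidComputer.GateBudget
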